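import Mathlib
import HarnessLib

/-!
# Crux `HypACumulant`, line `gnv` — HOLOMORPHIC FAMILIES: partial derivatives of a jointly smooth
# function that is holomorphic in a complex parameter are again holomorphic in the parameter

Route `route-HubbardSuperconductivity-ComplexGFFStiffness`, cruxes stmt-HubbardSuperconductivity-19154 /
-19155, shared research statement `OnePointLipschitz`, census entry (C3d′)/(H1) of
`CUMULANT-PLAN-cgffstiff1-g10.md`: to feed the Schwarz-lemma engine
(`…HypACumulantHolomorphicDifferences`) with the Taylor data of the renormalisation maps along complex
lines `(H + σU, K + σV)`, one needs that φ-DERIVATIVES of a family `F(σ, φ)` that is holomorphic in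
`σ` for each field `φ` (and jointly smooth) are again holomorphic in `σ`.  This file proves the
one-real-variable engine of that induction:

* **`differentiableOn_partialDeriv_of_holomorphic`** — if `F : ℂ × ℝ → ℂ` is jointly `C¹` (real
  sense) and `σ ↦ F(σ, t)` is holomorphic on an open set `U` for every `t`, then
  `σ ↦ ∂_t F(σ, 0)` (`= deriv (fun t => F (σ, t)) 0`) is holomorphic on `U` — the difference quotients
  `(F(σ,h) − F(σ,0))/h` are holomorphic and converge locally uniformly (mean value inequality +
  uniform continuity of `∂_t F` on compacts), and locally uniform limits of holomorphic functions are
  holomorphic (`TendstoLocallyUniformlyOn.differentiableOn`);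
* **`differentiableOn_iteratedFDeriv_apply_of_holomorphic`** — the field-direction form used by the
  renormalisation-group application: if `F : ℂ × E → ℂ` (`E` a real normed space of fields) is jointly
  `C^∞` and `σ ↦ F(σ, y)` is holomorphic on `U` for every `y`, then every Taylor coefficient
  `σ ↦ D^s_y F(σ,·)(y)(v_1,…,v_s)` (`iteratedFDeriv ℝ s`, applied to directions) is holomorphic on `U` and
  jointly smooth in `(σ, y)` — by induction on `s`: `D^{s+1}F(σ,·)(y)(v) = ∂_t|₀ D^sF(σ,·)(y + t v_0)(tail v)`
  (`iteratedFDeriv_succ_apply_left`, line derivative) and the one-variable engine; joint smoothness is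
  propagated by `ContDiff.fderiv_apply`.

With `…HypACumulantHolomorphicDifferences` this gives, for any family of functionals entire in the complex
data `(H, K)` at fixed real `q` with a sup bound on a complex ball, Lipschitz AND parallelogram
second-difference bounds of all its Taylor coefficients in `(H, K)` (census (C3d′)).

Pure analysis; nothing here is specific to the model.  All proved, no `sorry`.

## References
* S. Adams, S. Buchholz, R. Kotecký, S. Müller, arXiv:1910.13564, Ch. 10–11 (smoothness of the
  renormalisation maps, there by explicit multilinear estimates) [AdamsBuchholzKoteckyMuller2019].
-/

noncomputable section

-- `Summit.<Summit>.<Problem>`: single-conjunct summit, the duplicate component is mandated (D-0017).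
set_option linter.dupNamespace false

namespace Summit.HubbardSuperconductivity.HubbardSuperconductivity.Theorems.ComplexGFF

open Metric Set Filter Topology

/-- the partial derivative in the real variable along `t ↦ (σ, t)`. -/
theorem hasDerivAt_curve_snd {F : ℂ × ℝ → ℂ} {n : WithTop ℕ∞} (hF : ContDiff ℝ n F) (hn : 1 ≤ n) (σ : ℂ) (t : ℝ) :
    HasDerivAt (fun s : ℝ => F (σ, s)) (fderiv ℝ F (σ, t) (0, 1)) t := by
  have h1 : HasDerivAt (fun s : ℝ => ((σ, s) : ℂ × ℝ)) ((0 : ℂ), (1 : ℝ)) t :=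
    (hasDerivAt_const t σ).prodMk (hasDerivAt_id t)
  have hn0 : n ≠ 0 := ne_of_gt (lt_of_lt_of_le zero_lt_one hn)
  have h2 : HasFDerivAt F (fderiv ℝ F (σ, t)) (σ, t) := (hF.differentiable hn0 (σ, t)).hasFDerivAt
  exact h2.comp_hasDerivAt t h1

/-- **Holomorphy of the partial derivative.**  If `F : ℂ × ℝ → ℂ` is jointly `C¹` and
`σ ↦ F(σ,t)` is holomorphic on the open set `U` for every `t`, then `σ ↦ ∂_t F(σ, t₀)` is holomorphic
on `U`. -/
theorem differentiableOn_partialDeriv_of_holomorphic {U : Set ℂ} (hU : IsOpen U) {F : ℂ × ℝ → ℂ}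
    {n : WithTop ℕ∞} (hF : ContDiff ℝ n F) (hn : 1 ≤ n)
    (hhol : ∀ t : ℝ, DifferentiableOn ℂ (fun σ => F (σ, t)) U) (t₀ : ℝ) :
    DifferentiableOn ℂ (fun σ => deriv (fun t : ℝ => F (σ, t)) t₀) U := by
  -- the partial derivative as a jointly continuous function
  set Ft : ℂ × ℝ → ℂ := fun p => fderiv ℝ F p (0, 1) with hFt
  have hFt_cont : Continuous Ft := by
    have hn0 : n ≠ 0 := ne_of_gt (lt_of_lt_of_le zero_lt_one hn)
    have hc : Continuous (fderiv ℝ F) := hF.continuous_fderiv hn0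
    exact hc.clm_apply continuous_const
  have hderiv : ∀ σ t, HasDerivAt (fun s : ℝ => F (σ, s)) (Ft (σ, t)) t := fun σ t => hasDerivAt_curve_snd hF hn σ t
  have hderiv_eq : ∀ σ, deriv (fun t : ℝ => F (σ, t)) t₀ = Ft (σ, t₀) := fun σ => (hderiv σ t₀).deriv
  -- the difference quotients
  set q : ℕ → ℂ → ℂ := fun m σ => ((m : ℂ) + 1) * (F (σ, t₀ + 1 / ((m : ℝ) + 1)) - F (σ, t₀)) with hq
  have hq_hol : ∀ m, DifferentiableOn ℂ (q m) U := fun m =>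
    (((hhol _).sub (hhol _)).const_mul _)
  -- locally uniform convergence `q m → Ft (·, t₀)` on `U`
  have hconv : TendstoLocallyUniformlyOn q (fun σ => Ft (σ, t₀)) atTop U := by
    rw [tendstoLocallyUniformlyOn_iff_forall_isCompact hU]
    intro K hKU hK
    rw [Metric.tendstoUniformlyOn_iff]
    intro ε hε
    -- uniform continuity of `Ft` on the compact `K × [t₀, t₀ + 1]`
    have hKc : IsCompact (K ×ˢ Icc t₀ (t₀ + 1)) := hK.prod isCompact_Icc
    have huc := hKc.uniformContinuousOn_of_continuous hFt_cont.continuousOn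
    rw [Metric.uniformContinuousOn_iff] at huc
    obtain ⟨δ, hδ, hδε⟩ := huc (ε / 2) (half_pos hε)
    -- eventually `1/(m+1) < min δ 1`
    have hev : ∀ᶠ m : ℕ in atTop, (1 : ℝ) / ((m : ℝ) + 1) < min δ 1 := by
      have ht : Tendsto (fun m : ℕ => (1 : ℝ) / ((m : ℝ) + 1)) atTop (𝓝 0) := tendsto_one_div_add_atTop_nhds_zero_nat
      exact ht.eventually (gt_mem_nhds (lt_min hδ one_pos))
    filter_upwards [hev] with m hm
    intro σ hσ
    set h : ℝ := 1 / ((m : ℝ) + 1) with hh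
    have hh0 : 0 < h := by positivity
    have hhδ : h < δ := lt_of_lt_of_le hm (min_le_left _ _)
    have hh1 : h ≤ 1 := (lt_of_lt_of_le hm (min_le_right _ _)).le
    -- mean value inequality for `s ↦ F(σ,s) − (s − t₀) • Ft(σ,t₀)` on `[t₀, t₀ + h]`
    have hmv : ‖F (σ, t₀ + h) - h • Ft (σ, t₀) - F (σ, t₀)‖ ≤ ε / 2 * h := by
      have hf' : ∀ x ∈ Icc t₀ (t₀ + h),
          HasDerivWithinAt (fun s : ℝ => F (σ, s) - (s - t₀) • Ft (σ, t₀)) (Ft (σ, x) - Ft (σ, t₀)) (Icc t₀ (t₀ + h)) x := by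
        intro x _
        have h1 := hderiv σ x
        have h2 : HasDerivAt (fun s : ℝ => (s - t₀) • Ft (σ, t₀)) ((1 : ℝ) • Ft (σ, t₀)) x :=
          ((hasDerivAt_id x).sub_const t₀).smul_const _
        rw [one_smul] at h2
        exact (h1.sub h2).hasDerivWithinAt
      have hbound : ∀ x ∈ Ico t₀ (t₀ + h), ‖Ft (σ, x) - Ft (σ, t₀)‖ ≤ ε / 2 := by
        intro x hx
        have hxI : x ∈ Icc t₀ (t₀ + 1) := ⟨hx.1, le_trans hx.2.le (by linarith)⟩
        have ht₀I : t₀ ∈ Icc t₀ (t₀ + 1) := ⟨le_rfl, by linarith⟩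
        have hd : dist ((σ, x) : ℂ × ℝ) (σ, t₀) < δ := by
          rw [Prod.dist_eq, dist_self, Real.dist_eq, abs_of_nonneg (by linarith [hx.1])]
          exact max_lt hδ (by linarith [hx.2])
        have := hδε (σ, x) ⟨hσ, hxI⟩ (σ, t₀) ⟨hσ, ht₀I⟩ hd
        rw [dist_eq_norm] at this
        exact this.le
      have hmvt := norm_image_sub_le_of_norm_deriv_le_segment' hf' hbound (t₀ + h) ⟨by linarith, le_rfl⟩
      simp only [sub_self, zero_smul, sub_zero, add_sub_cancel_left] at hmvt
      simpa using hmvt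
    -- conclude `dist (Ft(σ,t₀)) (q m σ) < ε`
    rw [dist_eq_norm]
    set c : ℝ := (m : ℝ) + 1 with hc
    have hc0 : 0 < c := by positivity
    have hch : (c : ℂ) * (h : ℂ) = 1 := by
      rw [← Complex.ofReal_mul, show c * h = 1 by rw [hh]; field_simp]
      simp
    have hq_eq : q m σ = (c : ℂ) * (F (σ, t₀ + h) - F (σ, t₀)) := by
      simp only [hq, hh, hc]
      push_cast
      ring
    rw [Complex.real_smul] at hmv
    have e2 : Ft (σ, t₀) - (c : ℂ) * (F (σ, t₀ + h) - F (σ, t₀))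
        = -((c : ℂ) * (F (σ, t₀ + h) - (h : ℂ) * Ft (σ, t₀) - F (σ, t₀))) := by
      linear_combination (-(Ft (σ, t₀))) * hch
    rw [hq_eq, e2, norm_neg, norm_mul, Complex.norm_real, Real.norm_eq_abs, abs_of_pos hc0]
    calc c * ‖F (σ, t₀ + h) - (h : ℂ) * Ft (σ, t₀) - F (σ, t₀)‖ ≤ c * (ε / 2 * h) :=
          mul_le_mul_of_nonneg_left hmv hc0.le
      _ = ε / 2 := by rw [hh]; field_simp
      _ < ε := half_lt_self hε
  have hlim := hconv.differentiableOn (Eventually.of_forall hq_hol) hU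
  exact hlim.congr (fun σ _ => hderiv_eq σ)


/-! ### Field directions: Taylor coefficients of a holomorphic family of smooth functionals -/

section FieldDirections

variable {E : Type*} [NormedAddCommGroup E] [NormedSpace ℝ E]

/-- the line derivative of a differentiable scalar function: `fderiv g y w = deriv (t ↦ g (y + t•w)) 0`. -/
theorem fderiv_apply_eq_deriv_line {g : E → ℂ} {y : E} (hg : DifferentiableAt ℝ g y) (w : E) :
    fderiv ℝ g y w = deriv (fun t : ℝ => g (y + t • w)) 0 := by
  have hl : HasDerivAt (fun t : ℝ => y + t • w) w 0 := by
    have := ((hasDerivAt_id (0 : ℝ)).smul_const w).const_add y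
    simpa using this
  have h : HasDerivAt (fun t : ℝ => g (y + t • w)) (fderiv ℝ g y w) 0 := by
    have hg' : HasFDerivAt g (fderiv ℝ g (y + (0 : ℝ) • w)) (y + (0 : ℝ) • w) := by
      simpa using hg.hasFDerivAt
    have := hg'.comp_hasDerivAt (0 : ℝ) hl
    simpa [Function.comp_def] using this
  exact h.deriv.symm

/-- **Holomorphic families of smooth functionals have holomorphic Taylor coefficients.**  If
`F : ℂ × E → ℂ` is jointly `C^∞` (real sense) and `σ ↦ F(σ, y)` is holomorphic on the open set `U` for
every `y`, then for every order `s`, point `y` and directions `v`, the Taylor coefficient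
`σ ↦ D^s_y F(σ, ·)(y)(v_1, …, v_s)` is holomorphic on `U` (and jointly smooth in `(σ, y)`). -/
theorem differentiableOn_iteratedFDeriv_apply_of_holomorphic {U : Set ℂ} (hU : IsOpen U) {F : ℂ × E → ℂ}
    (hF : ContDiff ℝ (⊤ : WithTop ℕ∞) F) (hhol : ∀ y : E, DifferentiableOn ℂ (fun σ => F (σ, y)) U) (s : ℕ) :
    ∀ v : Fin s → E,
      ContDiff ℝ (⊤ : WithTop ℕ∞) (fun p : ℂ × E => iteratedFDeriv ℝ s (fun y => F (p.1, y)) p.2 v) ∧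
      ∀ y : E, DifferentiableOn ℂ (fun σ => iteratedFDeriv ℝ s (fun y => F (σ, y)) y v) U := by
  induction s with
  | zero =>
    intro v
    have e : ∀ (σ : ℂ) (y : E), iteratedFDeriv ℝ 0 (fun y => F (σ, y)) y v = F (σ, y) := fun σ y =>
      iteratedFDeriv_zero_apply v
    refine ⟨?_, fun y => ?_⟩
    · simp only [e]
      exact hF
    · simp only [e]
      exact hhol y
  | succ s ih =>
    intro v
    obtain ⟨hsmooth, hholo⟩ := ih (Fin.tail v)
    -- `g(σ, y) = D^s F(σ,·)(y)(tail v)`, jointly smooth, holomorphic in `σ`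
    set g : ℂ × E → ℂ := fun p => iteratedFDeriv ℝ s (fun y => F (p.1, y)) p.2 (Fin.tail v) with hg
    have hFσ : ∀ σ : ℂ, ContDiff ℝ (⊤ : WithTop ℕ∞) (fun y : E => F (σ, y)) := fun σ =>
      hF.comp ((contDiff_const (c := σ)).prodMk contDiff_id)
    -- the key identity `D^{s+1} F(σ,·)(y)(v) = fderiv (g(σ,·)) y (v 0)`
    have hkey : ∀ (σ : ℂ) (y : E), iteratedFDeriv ℝ (s + 1) (fun y => F (σ, y)) y v = fderiv ℝ (fun y => g (σ, y)) y (v 0) := by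
      intro σ y
      rw [iteratedFDeriv_succ_apply_left]
      have hd : DifferentiableAt ℝ (iteratedFDeriv ℝ s (fun y => F (σ, y))) y :=
        ((hFσ σ).differentiable_iteratedFDeriv (WithTop.coe_lt_top (s : ℕ∞))) y
      have hcomp : fderiv ℝ (fun y => g (σ, y)) y =
          (ContinuousMultilinearMap.apply ℝ (fun _ : Fin s => E) ℂ (Fin.tail v)).comp
            (fderiv ℝ (iteratedFDeriv ℝ s (fun y => F (σ, y))) y) := by
        have h := ((ContinuousMultilinearMap.apply ℝ (fun _ : Fin s => E) ℂ (Fin.tail v)).hasFDerivAt.comp y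
          hd.hasFDerivAt).fderiv
        simpa [hg, Function.comp_def] using h
      rw [hcomp]
      rfl
    -- joint smoothness of the new coefficient
    have hsmooth' : ContDiff ℝ (⊤ : WithTop ℕ∞) (fun p : ℂ × E => fderiv ℝ (fun y => g (p.1, y)) p.2 (v 0)) := by
      have hunc : ContDiff ℝ (⊤ : WithTop ℕ∞) (Function.uncurry fun (p : ℂ × E) (y : E) => g (p.1, y)) := by
        have e : (Function.uncurry fun (p : ℂ × E) (y : E) => g (p.1, y)) = g ∘ (fun q : (ℂ × E) × E => (q.1.1, q.2)) := by
          funext q; rfl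
        rw [e]
        exact hsmooth.comp ((contDiff_fst.comp contDiff_fst).prodMk contDiff_snd)
      exact hunc.fderiv_apply contDiff_snd contDiff_const le_top
    refine ⟨?_, fun y => ?_⟩
    · have e : (fun p : ℂ × E => iteratedFDeriv ℝ (s + 1) (fun y => F (p.1, y)) p.2 v)
          = fun p => fderiv ℝ (fun y => g (p.1, y)) p.2 (v 0) := by
        funext p; exact hkey p.1 p.2
      rw [e]; exact hsmooth'
    · -- holomorphy: the coefficient is the line derivative of `g`, apply the one-variable engine
      have hgy : ∀ σ : ℂ, DifferentiableAt ℝ (fun y => g (σ, y)) y := fun σ =>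
        (hsmooth.comp ((contDiff_const (c := σ)).prodMk contDiff_id)).differentiable (by simp) y
      have e : ∀ σ : ℂ, iteratedFDeriv ℝ (s + 1) (fun y => F (σ, y)) y v
          = deriv (fun t : ℝ => g (σ, y + t • (v 0))) 0 := by
        intro σ
        rw [hkey, fderiv_apply_eq_deriv_line (hgy σ)]
      have hG : ContDiff ℝ (⊤ : WithTop ℕ∞) (fun q : ℂ × ℝ => g (q.1, y + q.2 • (v 0))) :=
        hsmooth.comp (contDiff_fst.prodMk ((contDiff_const.add (contDiff_snd.smul contDiff_const))))
      have hGhol : ∀ t : ℝ, DifferentiableOn ℂ (fun σ => g (σ, y + t • (v 0))) U := fun t => hholo _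
      have h := differentiableOn_partialDeriv_of_holomorphic hU hG le_top hGhol 0
      refine (h.congr (fun σ _ => ?_))
      exact e σ

end FieldDirections

end Summit.HubbardSuperconductivity.HubbardSuperconductivity.Theorems.ComplexGFF

end
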